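/-
Copyright (c) 2026 the pub-hodgecm-mathlib formalisation cell (harness21).  Prover seat hodgecm-mathlib-K2Liu-p08 (g5), Track B «K2-LIT»,
#184♮ = hLiu418 = `stmt-HodgeConjecture-24832`; #42S payer road, organ S1 (local Siegel–Weil spanning), SPLIT HAND, letter (M2b)-split
(LEAD F0P6-plan (g14) BATCH #41/#44 «K2Liu-p08 (g5) = S1 split face + split twins of p01's (H1)–(H4) and of p26's (G)/(M2) organ»).
-/
import Summits.HodgeConjecture.HodgeConjecture.Theorems.K2LiuLatticePairMiddleProfile     -- ★ (R-c): `setIntegral_addSubgroup_addChar_mul`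
import Summits.HodgeConjecture.HodgeConjecture.Theorems.K2LiuMiddleProfileFactorisation   -- ★ (M2b) inert: `middleRow_of_middleProfiles` (cited, reused by the consumer)
import Literature.NumberTheory.Automorphic.LocalFieldHaarBalls                           -- ★ `measureReal_primePowBall` (`μ(𝔭^m) = q^{-m} μ(𝒪)`)
import Literature.NumberTheory.Automorphic.AddCharConductorExponent                     -- ★ `primePowBall` API, `AddChar.HasConductorExp`
import Mathlib.MeasureTheory.Integral.Prod
import HarnessLib

/-!
# Crux `HLiu418`, #42S organ S1, SPLIT HAND, letter (M2b)-split: FACTORISATION OF THE SPLIT MIDDLE PROFILE ROW —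
# `F_{Φ_k}(w₁·x) = (K · q_v^{-2k}) · g(x)` with `g` independent of the depth `k`

Cell `hodgecm-mathlib`, crux item hLiu418 = `stmt-HodgeConjecture-24832`; squad K2 ∕ K2Liu; LEAD F0P6-plan (g14); prover K2Liu-p08 (g5).
THEOREMS ONLY (no `def`, no instance, no notation, no named-fact hypothesis, no `sorry`); lane `--supports stmt-HodgeConjecture-24832 --as helper`.

WHY.  At a place `v` of `F` SPLIT in `E` (`E ⊗ F_v ≅ E_{w₀} × E_{σw₀}`, both `≅ F_v =: K`), the middle-cell profile of the local Siegel–Weil section of the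
split witness `Φ_k = 𝟙_{B₁(k)} − 𝟙_{B₂(k)}` (★ `K2LiuSplitWitnessPackageOfMoverFrame`, the six-block boxes of ★ `K2LiuSplitWitnessPackage`) is, along a Levi row
(★ (M2a-C) Haar-delta + tensor + Levi letters, K2Liu-p26 (g0); the split Levi-row reading (M2a-L)-split), the integral over `K⁶` of
`Ψ_x(α′β″ + α″β′ + D·γ′γ″)` (the split reading of `α·σβ + D₀·γ·σγ`: `z ↦ (z′, z″) = (z(w₀), (σz)(w₀))`, `σ` = swap) against the indicator
`𝟙[α′ ∈ 𝔭^{n′}, α″ ∈ 𝔭^{n″}] · (𝟙[β′ ∈ 𝔭^{n′}, β″ ∈ 𝔭^{n″}] − 𝟙[β′ ∈ 𝔭^{n′+1}, β″ ∈ 𝔭^{n″+1}]) · 𝟙[γ′ ∈ 𝔭^{n′+k}, γ″ ∈ 𝔭^{n″+k}]`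
(`n′, n″` the exponents of the two component rows).  Unlike the inert hand (★ `K2LiuMiddleProfileFactorisation`: ONE shell `U`, a unit condition constant
on it), the `β`-region `U = (𝔭^{n′} × 𝔭^{n″}) ∖ (𝔭^{n′+1} × 𝔭^{n″+1})` is not iso-valued; but orthogonality in `α` (★ (R-c) `setIntegral_addSubgroup_addChar_mul`,
twice) still produces a `k`-FREE `β`-factor `μ²(U ∩ (𝔭^{m−n″} × 𝔭^{m−n′}))` (`m` = conductor exponent of `Ψ_x`), and whenever that factor is non-zero one
`β`-coordinate sits on its shell inside the dual ball, forcing `m ≤ n′ + n″`, which kills the `γ`-phase on `𝔭^{n′+k} × 𝔭^{n″+k}` for EVERY `k ≥ 0`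
(`|D| ≤ 1`).  Hence `F_{Φ_k}(w₁·x) = K·c(x)·μ(𝔭^{n′})μ(𝔭^{n″})·μ²(U ∩ duals)·μ(𝔭^{n′+k})μ(𝔭^{n″+k})`, and `μ(𝔭^{n+k+1}) = q⁻¹μ(𝔭^{n+k})`
(★ `measureReal_primePowBall`) gives the two-depth rows `F_{Φ_k}(w₁x) = K·g(x)`, `F_{Φ_{k+1}}(w₁x) = (K·q⁻²)·g(x)` — the inputs `hfack ∕ hfack1`
(`K_k ∕ K_{k+1} = q_v²`, matching the duality letter `μ = −q_v²` of ★ `K2LiuSplitWitnessDuality`) of ★ `K2LiuSplitWitnessOffBigCell.hf₀off_split_witness_of_factorisations`.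
HEADS: §1 `isClosed_splitDualSet`, **`setIntegral_splitMiddleProfile_eq`** (abstract sets, Fubini + orthogonality), `factorisation_of_splitMiddleProfile`;
§2 `forall_primePowBall_mul_iff` (the dual-ball dictionary of a character of conductor exponent `m`), `splitDualSet_eq_prod`, `split_box_condition`,
**`setIntegral_splitMiddleProfile_balls`** (everything in `𝔭`-letters); §3 `measureReal_primePowBall_succ_mul`, **`splitMiddleRows_of_balls`** (the two-depth rows).
References: [WeilBNT1967] Ch. II §5 Prop. 12, Ch. VII §2 Prop. 2; [Tate1950] §2.2, §2.5; [Kudla1994] §3; [KudlaSweet1997] §1.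
HONEST LABEL.  Count-neutral helper: `HC_CM` is proved only modulo the 7 printed citations (2 remaining named inputs: hLiu418 = `stmt-HodgeConjecture-24832`,
h413 = `stmt-HodgeConjecture-24833`) until rung 0 closes.
-/

set_option autoImplicit false
set_option linter.dupNamespace false -- the mandated namespace repeats `HodgeConjecture.HodgeConjecture`

noncomputable section

open MeasureTheory Set
open scoped ENNReal NNReal
open Literature.NumberTheory.Automorphic Literature.NumberTheory.Automorphic.LocalFieldHaar
open Literature.NumberTheory.GaloisRepresentations Literature.NumberTheory.GaloisRepresentations.IsNonarchimedeanLocalField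
open Summit.HodgeConjecture.HodgeConjecture.Cruxes.HLiu418.K2LiuLatticePairMiddleProfile

namespace Summit.HodgeConjecture.HodgeConjecture.Cruxes.HLiu418.K2LiuSplitMiddleProfileFactorisation

variable {K : Type*} [Field K] [ValuativeRel K] [TopologicalSpace K] [IsNonarchimedeanLocalField K]
  [MeasurableSpace K] [BorelSpace K] (μ : Measure K) [μ.IsAddHaarMeasure]

/-! ## §1 The split middle profile integral over abstract sets -/

omit [ValuativeRel K] [IsNonarchimedeanLocalField K] [MeasurableSpace K] [BorelSpace K] in
/-- The split dual set `{(β′, β″) | Ψ(a·β″) = 1 ∀ a ∈ B′, Ψ(a·β′) = 1 ∀ a ∈ B″}` is closed (continuity of `Ψ`). [folklore] -/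
theorem isClosed_splitDualSet [IsTopologicalRing K] (Ψ : AddChar K Circle) (hΨ : Continuous Ψ) (B' B'' : Set K) :
    IsClosed {β : K × K | (∀ a ∈ B', Ψ (a * β.2) = 1) ∧ (∀ a ∈ B'', Ψ (a * β.1) = 1)} := by
  have h1 : {β : K × K | (∀ a ∈ B', Ψ (a * β.2) = 1) ∧ (∀ a ∈ B'', Ψ (a * β.1) = 1)} =
      (⋂ a ∈ B', {β : K × K | Ψ (a * β.2) = 1}) ∩ ⋂ a ∈ B'', {β : K × K | Ψ (a * β.1) = 1} := by
    ext β
    simp only [mem_setOf_eq, mem_inter_iff, mem_iInter]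
  rw [h1]
  exact (isClosed_biInter fun a _ => isClosed_eq (hΨ.comp (continuous_const.mul continuous_snd)) continuous_const).inter
    (isClosed_biInter fun a _ => isClosed_eq (hΨ.comp (continuous_const.mul continuous_fst)) continuous_const)

open scoped Classical in
/-- **THE SPLIT MIDDLE PROFILE INTEGRAL**: for a continuous additive character `Ψ` of the local field `K`, additive subgroups `B′, B″` and sets `U, C ⊆ K × K`
of finite measure, `∫_{((β,γ),α) ∈ (U × C) × (B′ × B″)} Ψ(α′β″ + α″β′ + D·γ′γ″) = μ(B′)·μ(B″)·μ²(U ∩ S)·μ²(C)`, where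
`S = {(β′,β″) | Ψ(·β″) ≡ 1 on B′, Ψ(·β′) ≡ 1 on B″}` is the split dual set, PROVIDED the box condition «`Ψ(D·γ′γ″) = 1` on `C` as soon as `U ∩ S ≠ ∅`»
(`hbox`).  Orthogonality in `α′` and `α″` separately (★ (R-c) `setIntegral_addSubgroup_addChar_mul`) and Fubini.
[cite: WeilBNT1967, Ch. II §5, Prop. 12] [cite: Kudla1994, §3 Thm. 3.1] -/
theorem setIntegral_splitMiddleProfile_eq (Ψ : AddChar K Circle) (hΨ : Continuous Ψ) (D : K)
    (B' B'' : AddSubgroup K) (hB'm : MeasurableSet (B' : Set K)) (hB'μ : μ B' ≠ ∞) (hB''m : MeasurableSet (B'' : Set K)) (hB''μ : μ B'' ≠ ∞)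
    {U C : Set (K × K)} (hU : MeasurableSet U) (hUμ : (μ.prod μ) U ≠ ∞) (hC : MeasurableSet C) (hCμ : (μ.prod μ) C ≠ ∞)
    (hbox : ∀ β ∈ U, (∀ a ∈ B', Ψ (a * β.2) = 1) → (∀ a ∈ B'', Ψ (a * β.1) = 1) → ∀ γ ∈ C, Ψ (D * γ.1 * γ.2) = 1) :
    ∫ y in (U ×ˢ C) ×ˢ ((B' : Set K) ×ˢ (B'' : Set K)), ((Ψ (y.2.1 * y.1.1.2 + y.2.2 * y.1.1.1 + D * y.1.2.1 * y.1.2.2) : Circle) : ℂ)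
        ∂(((μ.prod μ).prod (μ.prod μ)).prod (μ.prod μ)) =
      (μ.real B' : ℂ) * (μ.real B'' : ℂ) *
        ((μ.prod μ).real (U ∩ {β : K × K | (∀ a ∈ B', Ψ (a * β.2) = 1) ∧ (∀ a ∈ B'', Ψ (a * β.1) = 1)}) : ℂ) *
          ((μ.prod μ).real C : ℂ) := by
  haveI : SecondCountableTopology K := secondCountableTopology_localField K
  set S : Set (K × K) := {β : K × K | (∀ a ∈ B', Ψ (a * β.2) = 1) ∧ (∀ a ∈ B'', Ψ (a * β.1) = 1)} with hS
  have hSm : MeasurableSet S := (isClosed_splitDualSet Ψ hΨ (B' : Set K) (B'' : Set K)).measurableSet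
  -- continuity, integrability
  have hcont : Continuous fun y : ((K × K) × (K × K)) × (K × K) =>
      ((Ψ (y.2.1 * y.1.1.2 + y.2.2 * y.1.1.1 + D * y.1.2.1 * y.1.2.2) : Circle) : ℂ) := by
    refine continuous_subtype_val.comp (hΨ.comp ?_)
    refine (((continuous_fst.comp continuous_snd).mul (continuous_snd.comp (continuous_fst.comp continuous_fst))).add
      ((continuous_snd.comp continuous_snd).mul (continuous_fst.comp (continuous_fst.comp continuous_fst)))).add ?_
    exact (continuous_const.mul (continuous_fst.comp (continuous_snd.comp continuous_fst))).mul
      (continuous_snd.comp (continuous_snd.comp continuous_fst))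
  have hfin : (((μ.prod μ).prod (μ.prod μ)).prod (μ.prod μ)) ((U ×ˢ C) ×ˢ ((B' : Set K) ×ˢ (B'' : Set K))) ≠ ∞ := by
    rw [Measure.prod_prod, Measure.prod_prod, Measure.prod_prod]
    exact ENNReal.mul_ne_top (ENNReal.mul_ne_top hUμ hCμ) (ENNReal.mul_ne_top hB'μ hB''μ)
  have hint : IntegrableOn (fun y : ((K × K) × (K × K)) × (K × K) =>
      ((Ψ (y.2.1 * y.1.1.2 + y.2.2 * y.1.1.1 + D * y.1.2.1 * y.1.2.2) : Circle) : ℂ))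
      ((U ×ˢ C) ×ˢ ((B' : Set K) ×ˢ (B'' : Set K))) (((μ.prod μ).prod (μ.prod μ)).prod (μ.prod μ)) :=
    Measure.integrableOn_of_bounded (M := 1) hfin hcont.aestronglyMeasurable (Filter.Eventually.of_forall fun y => by rw [Circle.norm_coe])
  rw [setIntegral_prod _ hint]
  -- the inner `α`-integral, for `(β, γ) ∈ U × C`
  have hinner : ∀ bc ∈ U ×ˢ C, ∫ a in (B' : Set K) ×ˢ (B'' : Set K),
      ((Ψ (a.1 * bc.1.2 + a.2 * bc.1.1 + D * bc.2.1 * bc.2.2) : Circle) : ℂ) ∂(μ.prod μ) =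
      if bc.1 ∈ S then ((Ψ (D * bc.2.1 * bc.2.2) : Circle) : ℂ) * ((μ.real B' : ℂ) * (μ.real B'' : ℂ)) else 0 := by
    rintro ⟨β, γ⟩ -
    have h1 : ∀ a : K × K, ((Ψ (a.1 * β.2 + a.2 * β.1 + D * γ.1 * γ.2) : Circle) : ℂ) =
        ((Ψ (D * γ.1 * γ.2) : Circle) : ℂ) * (((Ψ (a.1 * β.2) : Circle) : ℂ) * ((Ψ (a.2 * β.1) : Circle) : ℂ)) := fun a => by
      rw [AddChar.map_add_eq_mul, AddChar.map_add_eq_mul, Circle.coe_mul, Circle.coe_mul]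
      ring
    simp_rw [h1]
    rw [integral_const_mul, setIntegral_prod_mul (fun a₁ : K => ((Ψ (a₁ * β.2) : Circle) : ℂ)) (fun a₂ : K => ((Ψ (a₂ * β.1) : Circle) : ℂ)),
      setIntegral_addSubgroup_addChar_mul μ Ψ B' hB'm β.2, setIntegral_addSubgroup_addChar_mul μ Ψ B'' hB''m β.1]
    by_cases h' : ∀ a ∈ B', Ψ (a * β.2) = 1
    · by_cases h'' : ∀ a ∈ B'', Ψ (a * β.1) = 1
      · rw [if_pos h', if_pos h'', if_pos (show β ∈ S from ⟨h', h''⟩)]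
      · rw [if_pos h', if_neg h'', if_neg (fun h : β ∈ S => h'' h.2), mul_zero, mul_zero]
    · rw [if_neg h', if_neg (fun h : β ∈ S => h' h.1), zero_mul, mul_zero]
  rw [setIntegral_congr_fun (hU.prod hC) hinner]
  -- the `γ`-phase is `1` on `S` (box condition): the integrand is an indicator
  have h2 : ∀ bc ∈ U ×ˢ C, (if bc.1 ∈ S then ((Ψ (D * bc.2.1 * bc.2.2) : Circle) : ℂ) * ((μ.real B' : ℂ) * (μ.real B'' : ℂ)) else 0) =
      (S ×ˢ (univ : Set (K × K))).indicator (fun _ => (μ.real B' : ℂ) * (μ.real B'' : ℂ)) bc := by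
    rintro ⟨β, γ⟩ hbc
    by_cases hβ : β ∈ S
    · rw [if_pos hβ, indicator_of_mem (mk_mem_prod hβ (mem_univ _)), hbox β hbc.1 hβ.1 hβ.2 γ hbc.2, Circle.coe_one, one_mul]
    · rw [if_neg hβ, indicator_of_notMem (fun h => hβ (mem_prod.1 h).1)]
  rw [setIntegral_congr_fun (hU.prod hC) h2, setIntegral_indicator (hSm.prod MeasurableSet.univ), setIntegral_const, Complex.real_smul,
    prod_inter_prod, inter_univ, measureReal_prod_prod]
  push_cast
  ring

variable {H : Type*} [Mul H] {Pred : H → Prop}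

open scoped Classical in
/-- **FACTORISATION OF A SPLIT MIDDLE PROFILE ROW** (abstract sets): if on the cell predicate
`F(w₁·x) = K·(c(x)·∫_{(U_x × C_x) × (B′_x × B″_x)} Ψ_x(α′β″ + α″β′ + D·γ′γ″))` (`hrow`) with the box condition `hbox` of `setIntegral_splitMiddleProfile_eq`,
then `F(w₁·x) = K·(c(x)·μ(B′_x)μ(B″_x)·μ²(U_x ∩ S_x)·μ²(C_x))` — the right-hand side mentions `D` and `C_x` only through `μ²(C_x)`.
[cite: WeilBNT1967, Ch. VII §2, Prop. 2] [cite: Kudla1994, §3 Thm. 3.1] [cite: KudlaSweet1997, §1] -/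
theorem factorisation_of_splitMiddleProfile (F : H → ℂ) (w₁ : H) (Kc : ℂ) (c : H → ℂ)
    (Ψ : H → AddChar K Circle) (hΨ : ∀ x, Pred x → Continuous (Ψ x)) (D : K)
    (B' B'' : H → AddSubgroup K) (hB'm : ∀ x, Pred x → MeasurableSet (B' x : Set K)) (hB'μ : ∀ x, Pred x → μ (B' x) ≠ ∞)
    (hB''m : ∀ x, Pred x → MeasurableSet (B'' x : Set K)) (hB''μ : ∀ x, Pred x → μ (B'' x) ≠ ∞)
    (U C : H → Set (K × K)) (hU : ∀ x, Pred x → MeasurableSet (U x)) (hUμ : ∀ x, Pred x → (μ.prod μ) (U x) ≠ ∞)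
    (hC : ∀ x, Pred x → MeasurableSet (C x)) (hCμ : ∀ x, Pred x → (μ.prod μ) (C x) ≠ ∞)
    (hbox : ∀ x, Pred x → ∀ β ∈ U x, (∀ a ∈ B' x, Ψ x (a * β.2) = 1) → (∀ a ∈ B'' x, Ψ x (a * β.1) = 1) →
      ∀ γ ∈ C x, Ψ x (D * γ.1 * γ.2) = 1)
    (hrow : ∀ x, Pred x → F (w₁ * x) =
      Kc * (c x * ∫ y in (U x ×ˢ C x) ×ˢ ((B' x : Set K) ×ˢ (B'' x : Set K)),
        ((Ψ x (y.2.1 * y.1.1.2 + y.2.2 * y.1.1.1 + D * y.1.2.1 * y.1.2.2) : Circle) : ℂ) ∂(((μ.prod μ).prod (μ.prod μ)).prod (μ.prod μ)))) :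
    ∀ x, Pred x → F (w₁ * x) =
      Kc * (c x * ((μ.real (B' x) : ℂ) * (μ.real (B'' x) : ℂ) *
        ((μ.prod μ).real (U x ∩ {β : K × K | (∀ a ∈ B' x, Ψ x (a * β.2) = 1) ∧ (∀ a ∈ B'' x, Ψ x (a * β.1) = 1)}) : ℂ) *
          ((μ.prod μ).real (C x) : ℂ))) := by
  intro x hx
  rw [hrow x hx, setIntegral_splitMiddleProfile_eq μ (Ψ x) (hΨ x hx) D (B' x) (B'' x) (hB'm x hx) (hB'μ x hx) (hB''m x hx) (hB''μ x hx)
    (hU x hx) (hUμ x hx) (hC x hx) (hCμ x hx) (hbox x hx)]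

/-! ## §2 Everything in `𝔭`-letters: balls `primePowBall K n`, a character of conductor exponent `m` -/

omit [TopologicalSpace K] [IsNonarchimedeanLocalField K] [MeasurableSpace K] [BorelSpace K] in
/-- **THE DUAL-BALL DICTIONARY**: for `Ψ` of conductor exponent `m`, «`Ψ(a·y) = 1` for all `a ∈ 𝔭^n`» ⟺ `y ∈ 𝔭^{m−n}` (★ `exists_mem_primePowBall_addChar_mul_ne_one`
one way, `𝔭^n·𝔭^{m−n} ⊆ 𝔭^m` the other). [cite: Tate1950, §2.5] -/
theorem forall_primePowBall_mul_iff [TopologicalSpace K] [IsNonarchimedeanLocalField K] {Ψ : AddChar K Circle} {m : ℤ}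
    (hm : Ψ.HasConductorExp m) (n : ℤ) (y : K) :
    (∀ a ∈ primePowBall K n, Ψ (a * y) = 1) ↔ y ∈ primePowBall K (m - n) := by
  constructor
  · intro h
    by_contra hy
    obtain ⟨x₀, hx₀, hne⟩ := exists_mem_primePowBall_addChar_mul_ne_one hm hy
    exact hne (h x₀ hx₀)
  · intro hy a ha
    have hay : a * y ∈ primePowBall K m := by
      have := mul_mem_primePowBall ha hy
      rwa [add_sub_cancel] at this
    exact hm.1 _ hay

omit [MeasurableSpace K] [BorelSpace K] in
/-- The split dual set of `(𝔭^{n′}, 𝔭^{n″})` for `Ψ` of conductor exponent `m` IS the product of dual balls `𝔭^{m−n″} × 𝔭^{m−n′}` (`β′` pairs with `α″ ∈ 𝔭^{n″}`,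
`β″` with `α′ ∈ 𝔭^{n′}`). [cite: Tate1950, §2.5] -/
theorem splitDualSet_eq_prod {Ψ : AddChar K Circle} {m : ℤ} (hm : Ψ.HasConductorExp m) (n' n'' : ℤ) :
    {β : K × K | (∀ a ∈ primePowBall K n', Ψ (a * β.2) = 1) ∧ (∀ a ∈ primePowBall K n'', Ψ (a * β.1) = 1)} =
      primePowBall K (m - n'') ×ˢ primePowBall K (m - n') := by
  ext β
  rw [mem_setOf_eq, forall_primePowBall_mul_iff hm, forall_primePowBall_mul_iff hm, mem_prod, and_comm]

omit [MeasurableSpace K] [BorelSpace K] in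
/-- **THE SPLIT BOX CONDITION**: if `(β′, β″) ∈ U = (𝔭^{n′} × 𝔭^{n″}) ∖ (𝔭^{n′+1} × 𝔭^{n″+1})` lies in the dual product `𝔭^{m−n″} × 𝔭^{m−n′}`, then one coordinate
sits on its shell inside its dual ball, so `m ≤ n′ + n″`, whence `D·γ′·γ″ ∈ 𝔭^m` for `γ′ ∈ 𝔭^{n′+k}`, `γ″ ∈ 𝔭^{n″+k}`, `|D| ≤ 1`, `k ≥ 0` — the `γ`-phase dies for
EVERY depth (this is where `D` dies for the split hand). [cite: Kudla1994, §3] -/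
theorem split_box_condition {Ψ : AddChar K Circle} {m : ℤ} (hm : Ψ.HasConductorExp m) {D : K} (hD : normAbs K D ≤ 1) (n' n'' : ℤ) (k : ℕ) :
    ∀ β ∈ (primePowBall K n' ×ˢ primePowBall K n'') \ (primePowBall K (n' + 1) ×ˢ primePowBall K (n'' + 1)),
      (∀ a ∈ primePowBall K n', Ψ (a * β.2) = 1) → (∀ a ∈ primePowBall K n'', Ψ (a * β.1) = 1) →
      ∀ γ ∈ primePowBall K (n' + k) ×ˢ primePowBall K (n'' + k), Ψ (D * γ.1 * γ.2) = 1 := by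
  intro β hβ h' h'' γ hγ
  rw [forall_primePowBall_mul_iff hm] at h' h''
  obtain ⟨-, hβnot⟩ := (mem_sdiff _).1 hβ
  -- `m ≤ n' + n''`: otherwise both coordinates would be one ball deeper
  have hmle : m ≤ n' + n'' := by
    by_contra hlt
    push Not at hlt
    exact hβnot (mk_mem_prod (primePowBall_antitone (by omega) h'') (primePowBall_antitone (by omega) h'))
  have hD0 : D ∈ primePowBall K 0 := by rw [mem_primePowBall_iff, zpow_zero]; exact hD
  obtain ⟨hγ1, hγ2⟩ := mem_prod.1 hγ
  have hmem : D * γ.1 * γ.2 ∈ primePowBall K (0 + (n' + k) + (n'' + k)) := mul_mem_primePowBall (mul_mem_primePowBall hD0 hγ1) hγ2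
  exact hm.1 _ (primePowBall_antitone (by omega) hmem)

open scoped Classical in
/-- **THE SPLIT MIDDLE PROFILE IN `𝔭`-LETTERS**: for `Ψ` continuous of conductor exponent `m`, `|D| ≤ 1`, exponents `n′, n″ ∈ ℤ` and depth `k ∈ ℕ`,
`∫ Ψ(α′β″ + α″β′ + D·γ′γ″)` over `α ∈ 𝔭^{n′} × 𝔭^{n″}`, `β ∈ U = (𝔭^{n′} × 𝔭^{n″}) ∖ (𝔭^{n′+1} × 𝔭^{n″+1})`, `γ ∈ 𝔭^{n′+k} × 𝔭^{n″+k}` equals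
`μ(𝔭^{n′})·μ(𝔭^{n″})·μ²(U ∩ (𝔭^{m−n″} × 𝔭^{m−n′}))·(μ(𝔭^{n′+k})·μ(𝔭^{n″+k}))` — the depth `k` enters ONLY through the last factor.
[cite: WeilBNT1967, Ch. II §5, Prop. 12] [cite: Tate1950, §2.5] [cite: Kudla1994, §3 Thm. 3.1] -/
theorem setIntegral_splitMiddleProfile_balls (Ψ : AddChar K Circle) (hΨ : Continuous Ψ) {m : ℤ} (hm : Ψ.HasConductorExp m)
    {D : K} (hD : normAbs K D ≤ 1) (n' n'' : ℤ) (k : ℕ) :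
    ∫ y in ((((primePowBall K n' ×ˢ primePowBall K n'') \ (primePowBall K (n' + 1) ×ˢ primePowBall K (n'' + 1))) ×ˢ
        (primePowBall K (n' + k) ×ˢ primePowBall K (n'' + k))) ×ˢ (primePowBall K n' ×ˢ primePowBall K n'')),
        ((Ψ (y.2.1 * y.1.1.2 + y.2.2 * y.1.1.1 + D * y.1.2.1 * y.1.2.2) : Circle) : ℂ) ∂(((μ.prod μ).prod (μ.prod μ)).prod (μ.prod μ)) =
      (μ.real (primePowBall K n') : ℂ) * (μ.real (primePowBall K n'') : ℂ) *
        ((μ.prod μ).real (((primePowBall K n' ×ˢ primePowBall K n'') \ (primePowBall K (n' + 1) ×ˢ primePowBall K (n'' + 1))) ∩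
            (primePowBall K (m - n'') ×ˢ primePowBall K (m - n'))) : ℂ) *
          ((μ.real (primePowBall K (n' + k)) : ℂ) * (μ.real (primePowBall K (n'' + k)) : ℂ)) := by
  haveI : SecondCountableTopology K := secondCountableTopology_localField K
  -- the balls as additive subgroups
  let B' : AddSubgroup K :=
    { carrier := primePowBall K n'
      add_mem' := fun ha hb => add_mem_primePowBall ha hb
      zero_mem' := zero_mem_primePowBall _
      neg_mem' := fun ha => neg_mem_primePowBall ha }
  let B'' : AddSubgroup K :=
    { carrier := primePowBall K n''
      add_mem' := fun ha hb => add_mem_primePowBall ha hb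
      zero_mem' := zero_mem_primePowBall _
      neg_mem' := fun ha => neg_mem_primePowBall ha }
  have hB' : (B' : Set K) = primePowBall K n' := rfl
  have hB'' : (B'' : Set K) = primePowBall K n'' := rfl
  have hmeas : ∀ j : ℤ, MeasurableSet (primePowBall K j) := fun j => measurableSet_primePowBall j
  have hfinμ : ∀ j : ℤ, μ (primePowBall K j) ≠ ∞ := fun j => (measure_primePowBall_lt_top μ j).ne
  have hUm : MeasurableSet ((primePowBall K n' ×ˢ primePowBall K n'') \ (primePowBall K (n' + 1) ×ˢ primePowBall K (n'' + 1))) :=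
    ((hmeas _).prod (hmeas _)).diff ((hmeas _).prod (hmeas _))
  have hUμ : (μ.prod μ) ((primePowBall K n' ×ˢ primePowBall K n'') \ (primePowBall K (n' + 1) ×ˢ primePowBall K (n'' + 1))) ≠ ∞ :=
    (lt_of_le_of_lt (measure_mono sdiff_subset) (by rw [Measure.prod_prod]; exact ENNReal.mul_lt_top (hfinμ _).lt_top (hfinμ _).lt_top)).ne
  have hCm : MeasurableSet (primePowBall K (n' + k) ×ˢ primePowBall K (n'' + k)) := (hmeas _).prod (hmeas _)
  have hCμ : (μ.prod μ) (primePowBall K (n' + k) ×ˢ primePowBall K (n'' + k)) ≠ ∞ := by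
    rw [Measure.prod_prod]; exact ENNReal.mul_ne_top (hfinμ _) (hfinμ _)
  have h := setIntegral_splitMiddleProfile_eq μ Ψ hΨ D B' B'' (hmeas n') (hfinμ n') (hmeas n'') (hfinμ n'') hUm hUμ hCm hCμ
    (fun β hβ h₁ h₂ => split_box_condition hm hD n' n'' k β hβ h₁ h₂)
  -- the split dual set of the two balls is the product of the dual balls
  have hSeq : {β : K × K | (∀ a ∈ B', Ψ (a * β.2) = 1) ∧ (∀ a ∈ B'', Ψ (a * β.1) = 1)} =
      primePowBall K (m - n'') ×ˢ primePowBall K (m - n') := splitDualSet_eq_prod hm n' n''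
  rw [hSeq, hB', hB'', measureReal_prod_prod] at h
  rw [h]
  push_cast
  ring

/-! ## §3 The two-depth rows: `K_k ∕ K_{k+1} = q²` -/

/-- `μ(𝔭^{j+1}) = q⁻¹ · μ(𝔭^{j})` (★ `measureReal_primePowBall`). [cite: Tate1950, §2.2, Lemma 2.2.5] -/
theorem measureReal_primePowBall_succ_mul (j : ℤ) :
    μ.real (primePowBall K (j + 1)) = (residueFieldCard K : ℝ)⁻¹ * μ.real (primePowBall K j) := by
  have hq : (residueFieldCard K : ℝ) ≠ 0 := Nat.cast_ne_zero.2 (residueFieldCard_ne_zero K)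
  rw [measureReal_primePowBall μ (j + 1), measureReal_primePowBall μ j, zpow_add_one₀ (inv_ne_zero hq)]
  ring

open scoped Classical in
/-- **THE TWO-DEPTH ROWS OF THE SPLIT HAND**: if the middle profiles of `F₁ = F_{Φ_k}` and `F₂ = F_{Φ_{k+1}}` along the split Levi row are the `𝔭`-letter
integrals of `setIntegral_splitMiddleProfile_balls` at depths `k` and `k + 1` with the SAME `K`, `c(x)`, `Ψ_x` (conductor exponent `m_x`), `D` (`|D| ≤ 1`) and
exponents `n′_x, n″_x` (`hrow₁`, `hrow₂`), then for ONE function `g` (the depth-`k` value divided by `K`): `F₁(w₁·x) = K·g(x)` and `F₂(w₁·x) = (K·q⁻²)·g(x)`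
on the cell predicate — the rows `hfack ∕ hfack1` of ★ `K2LiuSplitWitnessOffBigCell.hf₀off_split_witness_of_factorisations` with `K_k ∕ K_{k+1} = q²`
(and, with `K ≠ 0`, of ★ `K2LiuMiddleProfileFactorisation.middleRow_of_middleProfiles`). [cite: Kudla1994, §3 Thm. 3.1] [cite: KudlaSweet1997, §1] -/
theorem splitMiddleRows_of_balls (F₁ F₂ : H → ℂ) (w₁ : H) (Kc : ℂ) (c : H → ℂ)
    (Ψ : H → AddChar K Circle) (hΨ : ∀ x, Pred x → Continuous (Ψ x)) (m : H → ℤ) (hm : ∀ x, Pred x → (Ψ x).HasConductorExp (m x))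
    {D : K} (hD : normAbs K D ≤ 1) (n' n'' : H → ℤ) (k : ℕ)
    (hrow₁ : ∀ x, Pred x → F₁ (w₁ * x) =
      Kc * (c x * ∫ y in ((((primePowBall K (n' x) ×ˢ primePowBall K (n'' x)) \ (primePowBall K (n' x + 1) ×ˢ primePowBall K (n'' x + 1))) ×ˢ
        (primePowBall K (n' x + k) ×ˢ primePowBall K (n'' x + k))) ×ˢ (primePowBall K (n' x) ×ˢ primePowBall K (n'' x))),
        ((Ψ x (y.2.1 * y.1.1.2 + y.2.2 * y.1.1.1 + D * y.1.2.1 * y.1.2.2) : Circle) : ℂ) ∂(((μ.prod μ).prod (μ.prod μ)).prod (μ.prod μ))))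
    (hrow₂ : ∀ x, Pred x → F₂ (w₁ * x) =
      Kc * (c x * ∫ y in ((((primePowBall K (n' x) ×ˢ primePowBall K (n'' x)) \ (primePowBall K (n' x + 1) ×ˢ primePowBall K (n'' x + 1))) ×ˢ
        (primePowBall K (n' x + ((k + 1 : ℕ) : ℤ)) ×ˢ primePowBall K (n'' x + ((k + 1 : ℕ) : ℤ)))) ×ˢ (primePowBall K (n' x) ×ˢ primePowBall K (n'' x))),
        ((Ψ x (y.2.1 * y.1.1.2 + y.2.2 * y.1.1.1 + D * y.1.2.1 * y.1.2.2) : Circle) : ℂ) ∂(((μ.prod μ).prod (μ.prod μ)).prod (μ.prod μ)))) :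
    ∃ g : H → ℂ, (∀ x, Pred x → F₁ (w₁ * x) = Kc * g x) ∧
      (∀ x, Pred x → F₂ (w₁ * x) = (Kc * ((residueFieldCard K : ℂ)⁻¹ ^ 2)) * g x) := by
  refine ⟨fun x => c x * ((μ.real (primePowBall K (n' x)) : ℂ) * (μ.real (primePowBall K (n'' x)) : ℂ) *
      ((μ.prod μ).real (((primePowBall K (n' x) ×ˢ primePowBall K (n'' x)) \ (primePowBall K (n' x + 1) ×ˢ primePowBall K (n'' x + 1))) ∩
          (primePowBall K (m x - n'' x) ×ˢ primePowBall K (m x - n' x))) : ℂ) *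
        ((μ.real (primePowBall K (n' x + k)) : ℂ) * (μ.real (primePowBall K (n'' x + k)) : ℂ))), fun x hx => ?_, fun x hx => ?_⟩
  · rw [hrow₁ x hx, setIntegral_splitMiddleProfile_balls μ (Ψ x) (hΨ x hx) (hm x hx) hD (n' x) (n'' x) k]
  · rw [hrow₂ x hx, setIntegral_splitMiddleProfile_balls μ (Ψ x) (hΨ x hx) (hm x hx) hD (n' x) (n'' x) (k + 1)]
    have h1 : n' x + ((k + 1 : ℕ) : ℤ) = (n' x + k) + 1 := by push_cast; ring
    have h2 : n'' x + ((k + 1 : ℕ) : ℤ) = (n'' x + k) + 1 := by push_cast; ring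
    rw [h1, h2, measureReal_primePowBall_succ_mul μ (n' x + k), measureReal_primePowBall_succ_mul μ (n'' x + k)]
    push_cast
    ring

end Summit.HodgeConjecture.HodgeConjecture.Cruxes.HLiu418.K2LiuSplitMiddleProfileFactorisation
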